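import Summits.BirchSwinnertonDyer.BirchSwinnertonDyer.Theorems.GenusKolyvaginAtTwoGenusPrimitiveSupplyAtTwoPrimeHeegnerTwin
import Summits.BirchSwinnertonDyer.BirchSwinnertonDyer.Theorems.GenusKolyvaginAtTwoGenusPrimitiveSupplyAtTwoTwinConverse
import Literature.NumberTheory.EllipticCurves.LeadingTerm
import HarnessLib

/-!
# Route `GenusKolyvaginAtTwo`, crux `GenusPrimitiveSupplyAtTwo` (stmt-BirchSwinnertonDyer-22136):
# stub A WITH «DEF = 1» on the cell {Δ < 0, Ш(E)[2] = 0} — prime Heegner fields composed with the lead's twin bookkeeping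

Seat `bsd-line-gk2-p5` g6 (cell `bsd-f1-sign2`), SUPPLY lineage; third file of the g6 series (`…LocalTwoTorsion.lean`,
`…PrimeHeegnerTwin.lean`). Summit-side THEOREM-ONLY file (no definition, no named fact, no `sorry`),
`--supports stmt-BirchSwinnertonDyer-22136`.

WHAT. The lead's verdict on item 24947 (04:57Z) re-types the line's open kernel U with «DEF(W, d_K) = 1» and files a supply
`MinimalTwinSupplyDEF1`; REPAIR CENSUS v1.2 §6 names the needed SUPPLY″ = «an admissible Heegner field with DEF = 1 and a
(Sel₂-minimal) rank-one twin». On the cell {Δ_E < 0, #Sel₂(E) = 1} (`#Sel₂(E) = 1` ⟺ `E(ℚ)[2] = 0 ∧ rank 0 ∧ Ш(E)[2] = 0`,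
§1) THIS FILE composes `…PrimeHeegnerTwin.exists_prime_heegnerField_minimalTwin_of_prop33` (a PRIME Heegner field
`K = ℚ(√−ℓ)` with every K-clause of crux 22136, `2` split, DEF = 1, and a globally minimal twin `Wd ≅ E^{(−ℓ)}` with
`#Sel₂(Wd) = 2`, modulo Mazur–Rubin 2010 Prop. 3.3) with the lead bsd-line-gk2-p1's bookkeeping
(`…TwinConverse`: no rational `2`-torsion on the twin, root number `−1` from Modularity + Heegner, odd corank from
`2`-parity, corank `= 1` from the descent count, `r_an = 1` from the rank-one `2`-converse, non-CM):

* `stubA_DEF1_of_prop33_of_twoConverse` — for `E` in the A-class (globally minimal, non-CM, `r_an = 0`, `ρ_{E,2^n}` onto)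
  with `Δ_E < 0` and `#Sel₂(E) = 1`: beyond every bound a prime Heegner field with ALL of stub A's clauses (`K` admissible,
  `Wd` globally minimal, non-CM, `r_an(Wd) = 1`, `#Sel₂(Wd) = 2`) AND DEF(W,K) = 1 AND `2` split — modulo the PRINT facts
  `MazurRubin2010.prop33_rat`, `exists_isNewformOf`, `p_parity · 2` (for elliptic curves) and the OPEN rank-one `2`-converse
  (clause-free form, as in the lead's `stub_minimalTwinSupplyAtTwo_of_twoConverse`);
* `stubA_DEF1_of_items` — the same with the `2`-converse and the print inputs taken BY NAME as the route's items
  `RankOneTwoConverse` (19220) ∧ `RankOneTwoConverseOffSemistableAtTwo` (24948) ∧ `ModularityExistsNewform` (19382) ∧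
  `TwoParityDD` (24949), plus `prop33_rat`;
* §1 `natCard_selmerGroup_two_eq_one_of_rank_zero` / `…_of_analyticRank_zero`: `#Sel₂(E) = 1` from rank `0` (resp.
  `r_an = 0` and the Gross–Zagier–Kolyvagin fact `rank_eq_analyticRank_of_analyticRank_le_one` = item 19921),
  `ρ̄_{E,2}` onto and `Ш(E)[2] = 0` (descent count, tree THEOREM `natCard_selmerGroup_eq`) — so the cell is exactly the
  habitat's «Ш(E)[2] = 0 ∧ Δ < 0» part.

So on that part of the habitat SUPPLY″ / `MinimalTwinSupplyDEF1` costs NOTHING beyond what stub A already cost (print + the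
`2`-converse): the «DEF = 1» re-typing is free there, and `K` ranges over all large prime Heegner fields with `ℓ ≡ 7 (mod 8)`.
References: [MazurRubin2010] Prop. 3.3; [DokchitserDokchitserAnnals2010] Thm. 1.4; [Darmon2004] Thm. 3.17; [SilvermanAEC2009]
X.4.2; [GrossLMS1991] §1. No item is closed by this file; BSD is not proved by any of this.
-/

set_option linter.dupNamespace false -- tree convention: `Summit.BirchSwinnertonDyer.BirchSwinnertonDyer.Theorems` (summit = sub-problem)
set_option autoImplicit false

noncomputable section

open scoped Classical AddSubgroup

open NumberField WeierstrassCurve Literature.NumberTheory.EllipticCurves Literature.NumberTheory.EllipticCurves.ModularForms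

namespace Summit.BirchSwinnertonDyer.BirchSwinnertonDyer.Theorems.GenusKolyTwin

/-! ## §1. The cell: `#Sel₂(E) = 1` ⟸ rank `0`, `E(ℚ)[2] = 0`, `Ш(E)[2] = 0` -/

/-- **`#Sel₂(E) = 1` from rank `0`, irreducible `E[2]` and `Ш(E)[2] = 0`** (descent count `#Sel₂ = 2^{rank}·#E(ℚ)[2]·#Ш[2]`,
Silverman X.4.2, tree THEOREM `natCard_selmerGroup_eq`). [cite: SilvermanAEC2009, Thm. X.4.2] -/
theorem natCard_selmerGroup_two_eq_one_of_rank_zero (V : WeierstrassCurve ℚ) [V.IsElliptic] (hr : V.mordellWeilRank = 0)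
    (hirr : V.HasIrreducibleModPGaloisRep 2)
    (hsha : Nat.card (V.sha ⊓ V.galH1[((2 : ℕ) : ℤ)] : AddSubgroup V.galH1) = 1) :
    Nat.card (V.selmerGroup 2) = 1 := by
  haveI : Fact (Nat.Prime 2) := ⟨Nat.prime_two⟩
  have htors : Nat.card V.toAffine.Point[((2 : ℕ) : ℤ)] = 1 := natCard_torsionBy_eq_one_of_hasIrreducibleModPGaloisRep V 2 hirr
  have hcard₀ := V.natCard_selmerGroup_eq (n := 2) two_ne_zero
  have hcard : Nat.card (V.selmerGroup ((2 : ℕ) : ℤ)) =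
      2 ^ V.mordellWeilRank * Nat.card V.toAffine.Point[((2 : ℕ) : ℤ)] *
        Nat.card (V.sha ⊓ V.galH1[((2 : ℕ) : ℤ)] : AddSubgroup V.galH1) := by
    convert hcard₀
  rw [hr, htors, hsha, pow_zero, mul_one, mul_one, Nat.cast_ofNat] at hcard
  exact hcard

/-- **On the habitat: `#Sel₂(E) = 1` ⟺-half from `r_an(E) = 0`, `ρ̄_{E,2}` onto and `Ш(E)[2] = 0`**, the rank being `0` by
the Gross–Zagier–Kolyvagin theorem (named fact `rank_eq_analyticRank_of_analyticRank_le_one`, the route's item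
`MultPublishedInputsAtTwo`, hypothesis `hGZK`). [cite: SilvermanAEC2009, Thm. X.4.2] -/
theorem natCard_selmerGroup_two_eq_one_of_analyticRank_zero (hGZK : rank_eq_analyticRank_of_analyticRank_le_one)
    (V : WeierstrassCurve ℚ) [V.IsElliptic] (hr0 : V.analyticRank = 0) (hsurj : V.HasSurjectiveModNGaloisRep ((2 : ℤ) ^ 1))
    (hsha : Nat.card (V.sha ⊓ V.galH1[((2 : ℕ) : ℤ)] : AddSubgroup V.galH1) = 1) :
    Nat.card (V.selmerGroup 2) = 1 := by
  haveI : Fact (Nat.Prime 2) := ⟨Nat.prime_two⟩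
  haveI : NeZero ((2 : ℕ) : ℚ) := ⟨by norm_num⟩
  have hr : V.mordellWeilRank = 0 := by rw [(hGZK V (by rw [hr0]; exact zero_le_one)).1, hr0]
  exact natCard_selmerGroup_two_eq_one_of_rank_zero V hr
    (hasIrreducibleModPGaloisRep_of_hasSurjectiveModNGaloisRep V 2 (by simpa using hsurj)) hsha

/-! ## §2. Stub A with DEF = 1 on the cell, modulo print and the `2`-converse -/

/-- **Stub A WITH «DEF = 1» on the cell {Δ < 0, #Sel₂(E) = 1}, modulo Mazur–Rubin Prop. 3.3, Modularity, `2`-parity (for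
elliptic curves) and the clause-free rank-one `2`-converse.** For `E` in the A-class with `Δ_E < 0` and `#Sel₂(E) = 1`:
beyond every bound `n` there are a prime `ℓ > n` and `K = ℚ(√−ℓ)` with: `K` imaginary quadratic, `d_K = −ℓ` odd `≠ −3`,
Heegner for `N_E`, `d_K·(−|Δ|)`, `d_K·(−2|Δ|)` non-squares, `2` split in `K`, DEF(W,K) = 1 (the `2`-division cubic has exactly
one root mod `ℓ`), and a globally minimal `Wd ≅ E^{(d_K)}` which is non-CM with `r_an(Wd) = 1` and `#Sel₂(Wd) = 2`.
[cite: MazurRubin2010, Prop. 3.3] [cite: DokchitserDokchitserAnnals2010, Thm. 1.4] [cite: Darmon2004, §3.6 Thm. 3.17] -/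
theorem stubA_DEF1_of_prop33_of_twoConverse (h33 : MazurRubin2010.prop33_rat) (hmod : exists_isNewformOf)
    (hpar : ∀ (V : WeierstrassCurve ℚ) [V.IsElliptic], p_parity V 2)
    (hconv : ∀ (V : WeierstrassCurve ℚ) [V.IsElliptic] [V.IsGloballyMinimal],
      ¬ V.HasCM → V.selmerCorank 2 = 1 → V.analyticRank = 1)
    (W : WeierstrassCurve ℚ) [W.IsElliptic] [W.IsGloballyMinimal] (hcm : ¬ W.HasCM) (hr0 : W.analyticRank = 0)
    (hρ : ∀ n : ℕ, 0 < n → W.HasSurjectiveModNGaloisRep ((2 : ℤ) ^ n)) (hΔ : W.Δ < 0)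
    (h1 : Nat.card (W.selmerGroup 2) = 1) (n : ℕ) :
    ∃ (K : Type) (_ : Field K) (_ : NumberField K) (ℓ : ℕ), ℓ.Prime ∧ n < ℓ ∧
      IsImaginaryQuadratic K ∧ discr K = -(ℓ : ℤ) ∧ Odd (discr K) ∧ discr K ≠ -3 ∧
      SatisfiesHeegnerHypothesis (W.conductorNorm ℤ) K ∧
      ¬ IsSquare ((discr K : ℚ) * -|W.Δ|) ∧ ¬ IsSquare ((discr K : ℚ) * (-(2 * |W.Δ|))) ∧
      ((Ideal.span {(2 : ℤ)}).primesOver (𝓞 K)).ncard = 2 ∧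
      (∃! x : ZMod ℓ, 4 * x ^ 3 + ((integralModelInt W).b₂ : ZMod ℓ) * x ^ 2 +
        2 * ((integralModelInt W).b₄ : ZMod ℓ) * x + ((integralModelInt W).b₆ : ZMod ℓ) = 0) ∧
      ∃ (Wd : WeierstrassCurve ℚ) (_ : Wd.IsElliptic) (_ : Wd.IsGloballyMinimal),
        (∃ C : VariableChange ℚ, C • W.quadraticTwist (discr K : ℚ) = Wd) ∧
        ¬ Wd.HasCM ∧ Wd.analyticRank = 1 ∧ Nat.card (Wd.selmerGroup 2) = 2 := by
  obtain ⟨K, iF, iN, ℓ, hℓ, hℓn, hK, hd, hodd, hd3, hH, hsq1, hsq2, h2K, hT, Wd, iE, iM, hWd, hSel⟩ :=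
    exists_prime_heegnerField_minimalTwin_of_prop33 W h33 hΔ h1 n
  refine ⟨K, iF, iN, ℓ, hℓ, hℓn, hK, hd, hodd, hd3, hH, hsq1, hsq2, h2K, hT, Wd, iE, iM, hWd, ?_, ?_, hSel⟩
  · exact GenusKoly.twin_not_hasCM W hcm (by exact_mod_cast NumberField.discr_ne_zero K) Wd hWd
  · have hdK : (NumberField.discr K : ℚ) ≠ 0 := by exact_mod_cast NumberField.discr_ne_zero K
    have hcmd : ¬ Wd.HasCM := GenusKoly.twin_not_hasCM W hcm hdK Wd hWd
    have htors := GenusKoly.natCard_twoTorsion_twin_eq_one W (hρ 1 one_pos) hdK Wd hWd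
    have hw := GenusKoly.rootNumber_twin_eq_neg_one hmod W hr0 K hK hH Wd hWd
    have hco := GenusKoly.selmerCorank_two_eq_one_of_card_selmerGroup_two Wd htors hSel
      (GenusKoly.odd_selmerCorank_two_of_p_parity Wd (hpar Wd) hw)
    exact hconv Wd hcmd hco

/-- **The same, with the inputs BY NAME as the route's items**: `MazurRubin2010.prop33_rat` (print, not an item) and the
route's `ModularityExistsNewform` (19382), `TwoParityDD` (24949), `RankOneTwoConverse` (19220),
`RankOneTwoConverseOffSemistableAtTwo` (24948) — the two `2`-converse items together give the clause-free converse for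
non-CM globally minimal curves. [cite: MazurRubin2010, Prop. 3.3] [cite: DokchitserDokchitserAnnals2010, Thm. 1.4] -/
theorem stubA_DEF1_of_items (h33 : MazurRubin2010.prop33_rat)
    (hmod : Summit.BirchSwinnertonDyer.BirchSwinnertonDyer.Theses.GenusKolyvaginAtTwo.ModularityExistsNewform)
    (hpar : Summit.BirchSwinnertonDyer.BirchSwinnertonDyer.Theses.GenusKolyvaginAtTwo.TwoParityDD)
    (hconv : Summit.BirchSwinnertonDyer.BirchSwinnertonDyer.Theses.GenusKolyvaginAtTwo.RankOneTwoConverse)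
    (hconv' : Summit.BirchSwinnertonDyer.BirchSwinnertonDyer.Theses.GenusKolyvaginAtTwo.RankOneTwoConverseOffSemistableAtTwo)
    (W : WeierstrassCurve ℚ) [W.IsElliptic] [W.IsGloballyMinimal] (hcm : ¬ W.HasCM) (hr0 : W.analyticRank = 0)
    (hρ : ∀ n : ℕ, 0 < n → W.HasSurjectiveModNGaloisRep ((2 : ℤ) ^ n)) (hΔ : W.Δ < 0)
    (h1 : Nat.card (W.selmerGroup 2) = 1) (n : ℕ) :
    ∃ (K : Type) (_ : Field K) (_ : NumberField K) (ℓ : ℕ), ℓ.Prime ∧ n < ℓ ∧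
      IsImaginaryQuadratic K ∧ discr K = -(ℓ : ℤ) ∧ Odd (discr K) ∧ discr K ≠ -3 ∧
      SatisfiesHeegnerHypothesis (W.conductorNorm ℤ) K ∧
      ¬ IsSquare ((discr K : ℚ) * -|W.Δ|) ∧ ¬ IsSquare ((discr K : ℚ) * (-(2 * |W.Δ|))) ∧
      ((Ideal.span {(2 : ℤ)}).primesOver (𝓞 K)).ncard = 2 ∧
      (∃! x : ZMod ℓ, 4 * x ^ 3 + ((integralModelInt W).b₂ : ZMod ℓ) * x ^ 2 +
        2 * ((integralModelInt W).b₄ : ZMod ℓ) * x + ((integralModelInt W).b₆ : ZMod ℓ) = 0) ∧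
      ∃ (Wd : WeierstrassCurve ℚ) (_ : Wd.IsElliptic) (_ : Wd.IsGloballyMinimal),
        (∃ C : VariableChange ℚ, C • W.quadraticTwist (discr K : ℚ) = Wd) ∧
        ¬ Wd.HasCM ∧ Wd.analyticRank = 1 ∧ Nat.card (Wd.selmerGroup 2) = 2 := by
  refine stubA_DEF1_of_prop33_of_twoConverse h33 hmod (fun V _ => hpar V) (fun V _ _ hcmV hco => ?_)
    W hcm hr0 hρ hΔ h1 n
  by_cases hred : (Rank1Residual.GoodOrd V 2 ∨ Rank1Residual.Mult V 2)
  · exact hconv V hcmV hred hco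
  · exact hconv' V hcmV hred hco

end Summit.BirchSwinnertonDyer.BirchSwinnertonDyer.Theorems.GenusKolyTwin
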